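import Mathlib.Analysis.Normed.Group.Ultra
import Mathlib.Analysis.Normed.Module.Ball.Pointwise
import Mathlib.Topology.MetricSpace.Bounded
import Mathlib.Topology.Order.Compact
import Mathlib.Analysis.Normed.Field.Basic
import Mathlib.Topology.MetricSpace.ProperSpace
import Mathlib.Order.Closure
import HarnessLib

/-!
# [IUTchIII] Remark 3.9.5 (i)(ii): the holomorphic hull of a region in a direct sum of local fields

Mochizuki, *Inter-universal Teichmüller Theory III*, Rmk. 3.9.5, kurims manuscript pp. 126–128, read on
the page. (i): "Let `U ⊆ I^ℚ(−)` be a subset that contains a relatively compact subset whose log-volume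
is finite [i.e., `> −∞`]. If `U` is relatively compact, then we define the holomorphic hull of `U` to be
the smallest subset of the form `H = λ·O` — where, relative to the direct sum decomposition of `I^ℚ(−)`
as a direct sum of fields, `λ ∈ I^ℚ(−)` is an element such that each component of `λ` [i.e., relative to
this direct sum decomposition] is nonzero — that contains `U`. If `U` is not relatively compact, then we
define the holomorphic hull of `U` to be `I^ℚ(−)`. One verifies immediately that the holomorphic hull is
well-defined [under the conditions stated]." (ii): "Write `P := {P ⊆ I^ℚ(−) | P is a direct product
region}`; `H := {H ⊊ I^ℚ(−) | H is a hull}` … the operation of forming the hull … determines a map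
`φ : P → H` that may be characterized uniquely by the following properties (P1) `φ(H) = H`, for any
`H ∈ H`; (P2) `P ⊆ φ(P)`, for any `P ∈ P`; (P3) `φ(P₁) ⊆ φ(P₂)`, for any `P₁, P₂ ∈ P` such that
`P₁ ⊆ P₂`. Indeed, … it follows formally from (P1), (P2), (P3) that `φ(P) = ⋂_{H ∋ H ⊇ P} H`."
LANA §5.2 (d) p. 29: "the holomorphic hull of `S` … is the smallest `VC(O)`-submodule of `VC(K)` that
contains `S`"; Dupuy–Hilado §4.12: "the smallest polydisc containing `Ω`".

This file makes the hull a REAL definition on a finite direct sum `L = Π j, K j` of nonarchimedean local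
fields (norm presentation; `O_L = ∏ closedBall 0 1`), for ARBITRARY subsets, agreeing with the printed
one under the printed conditions:

* `hullSet K c = c·O_L = ∏_j closedBall 0 ‖c_j‖` and `IsHullSet` ("subsets of the form `λ·O`, each
  component of `λ` nonzero"); `hullRadius U j = sup_{u∈U} ‖u_j‖`;
* `holomorphicHull K U` := `∏_j closedBall 0 (hullRadius U j)` if `U` is bounded (= relatively compact,
  `L` being proper), `univ` otherwise;
* `subset_holomorphicHull` (P2), `holomorphicHull_mono` (P3), `holomorphicHull_hullSet` (P1),
  `holomorphicHull_subset_of_isHullSet` + `isHullSet_holomorphicHull` (it IS the smallest hull set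
  containing `U`, for `U` bounded and NONDEGENERATE: `∀ j, ∃ u ∈ U, u_j ≠ 0` — implied by the printed
  "contains a … subset whose log-volume is finite"), `holomorphicHull_eq_sInter` ("`φ(P) = ⋂ H`"),
  idempotence, and the packaging `hullClosureOperator K : ClosureOperator (Set (Π j, K j))`.

The key lemma `exists_norm_apply_eq_hullRadius` (the sup of the `j`-th norms over a bounded
nondegenerate `U` is ATTAINED, by local constancy of an ultrametric norm away from `0`) is what makes
the hull "well-defined [under the conditions stated]". [cite: Mochizuki2012, IUTchIII Rmk. 3.9.5 (i)(ii) pp. 126–128]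
[cite: LANA2026Report, §5.2 (d) p. 29] [cite: DupuyHilado2025, §4.12 p. 16]
Deliberately NOT here: log-volumes of hulls and the "hull-approximants" `Φ(P)`, `Ξ(P)` of Rmk. 3.9.5
(iii)–(iv) (next file), the identification with the `O_L`-span (LANA's form), any judgement on Cor. 3.12.
-/

noncomputable section

open Set Metric Bornology TopologicalSpace
open scoped Pointwise

namespace Literature.IUT.LogVolume

variable {J : Type*} (K : J → Type*) [∀ j, NontriviallyNormedField (K j)]

/-! ### Hull sets `λ·O` and radii -/

/-- The polydisc `∏_j closedBall 0 r_j ⊆ ⊕_j K_j` of radii `r`. [cite: DupuyHilado2025, §4.12 p. 16] -/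
def polydisc (r : J → ℝ) : Set (Π j, K j) := Set.pi univ (fun j => closedBall (0 : K j) (r j))

/-- Membership in a polydisc: `x ∈ ∏ closedBall 0 r_j ↔ ∀ j, ‖x_j‖ ≤ r_j`.
[cite: DupuyHilado2025, §4.12 p. 16] -/
theorem mem_polydisc {r : J → ℝ} {x : Π j, K j} : x ∈ polydisc K r ↔ ∀ j, ‖x j‖ ≤ r j := by
  simp [polydisc]

/-- Polydiscs are monotone in the radii. [cite: DupuyHilado2025, §4.12 p. 16] -/
theorem polydisc_mono {r s : J → ℝ} (h : ∀ j, r j ≤ s j) : polydisc K r ⊆ polydisc K s :=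
  fun _ hx => (mem_polydisc K).mpr fun j => ((mem_polydisc K).mp hx j).trans (h j)

/-- The **hull set** `c·O_L = ∏_j closedBall 0 ‖c_j‖` determined by `c ∈ L = ⊕ K_j` ("subsets of the
form `λ·O`"). [cite: Mochizuki2012, IUTchIII Rmk. 3.9.5 (i) p. 127] -/
def hullSet (c : Π j, K j) : Set (Π j, K j) := polydisc K (fun j => ‖c j‖)

/-- `c·O_L` is literally the set of products `c·x`, `x ∈ O_L = ∏ closedBall 0 1`, when every `c_j ≠ 0`.
[cite: Mochizuki2012, IUTchIII Rmk. 3.9.5 (i) p. 127] -/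
theorem hullSet_eq_image_mul (c : Π j, K j) (hc : ∀ j, c j ≠ 0) :
    hullSet K c = (fun x => c * x) '' polydisc K (fun _ => 1) := by
  ext x
  simp only [hullSet, mem_polydisc, mem_image]
  constructor
  · intro hx
    refine ⟨fun j => (c j)⁻¹ * x j, fun j => ?_, ?_⟩
    · rw [norm_mul, norm_inv]
      have hcj : 0 < ‖c j‖ := norm_pos_iff.mpr (hc j)
      rw [inv_mul_le_iff₀ hcj, mul_one]
      exact hx j
    · funext j
      simp [Pi.mul_apply, mul_inv_cancel_left₀ (hc j)]
  · rintro ⟨y, hy, rfl⟩ j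
    rw [Pi.mul_apply, norm_mul]
    exact mul_le_of_le_one_right (norm_nonneg _) (hy j)

/-- A **hull** in the sense of Rmk. 3.9.5 (i): a subset of the form `λ·O_L` with every component of `λ`
nonzero. [cite: Mochizuki2012, IUTchIII Rmk. 3.9.5 (i) p. 127] -/
def IsHullSet (H : Set (Π j, K j)) : Prop := ∃ c : Π j, K j, (∀ j, c j ≠ 0) ∧ H = hullSet K c

/-- **Nondegenerate** subsets: some element has nonzero `j`-th component, for every `j` (the content, for
the hull, of "contains a relatively compact subset whose log-volume is finite").
[cite: Mochizuki2012, IUTchIII Rmk. 3.9.5 (i) p. 127] -/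
def IsNondegenerate (U : Set (Π j, K j)) : Prop := ∀ j, ∃ u ∈ U, u j ≠ 0

/-- A hull set is nondegenerate (it contains `λ`). [cite: Mochizuki2012, IUTchIII Rmk. 3.9.5 (i) p. 127] -/
theorem IsHullSet.isNondegenerate {H : Set (Π j, K j)} (h : IsHullSet K H) : IsNondegenerate K H := by
  obtain ⟨c, hc, rfl⟩ := h
  exact fun j => ⟨c, (mem_polydisc K).mpr fun i => le_rfl, hc j⟩

/-- The **`j`-th radius** of `U`: `sup_{u ∈ U} ‖u_j‖`. [cite: DupuyHilado2025, §4.12 p. 16] -/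
def hullRadius (U : Set (Π j, K j)) (j : J) : ℝ := sSup ((fun u : Π j, K j => ‖u j‖) '' U)

/-- `hullRadius U j ≤ R` as soon as all `‖u_j‖ ≤ R` (`U` nonempty).
[cite: DupuyHilado2025, §4.12 p. 16] -/
theorem hullRadius_le {U : Set (Π j, K j)} (hne : U.Nonempty) {j : J} {R : ℝ}
    (h : ∀ u ∈ U, ‖u j‖ ≤ R) : hullRadius K U j ≤ R :=
  csSup_le (hne.image _) (by rintro _ ⟨u, hu, rfl⟩; exact h u hu)

/-- `hullRadius U j ≤ R` for `R ≥ 0` as soon as all `‖u_j‖ ≤ R` (any `U`).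
[cite: DupuyHilado2025, §4.12 p. 16] -/
theorem hullRadius_le_of_nonneg {U : Set (Π j, K j)} {j : J} {R : ℝ} (hR : 0 ≤ R)
    (h : ∀ u ∈ U, ‖u j‖ ≤ R) : hullRadius K U j ≤ R := by
  by_cases hne : U.Nonempty
  · exact hullRadius_le K hne h
  · rw [not_nonempty_iff_eq_empty] at hne
    subst hne
    simpa [hullRadius] using hR

/-- The radii are nonnegative. [cite: DupuyHilado2025, §4.12 p. 16] -/
theorem hullRadius_nonneg (U : Set (Π j, K j)) (j : J) : 0 ≤ hullRadius K U j := by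
  by_cases hne : ((fun u : Π j, K j => ‖u j‖) '' U).Nonempty
  · by_cases hb : BddAbove ((fun u : Π j, K j => ‖u j‖) '' U)
    · obtain ⟨_, ⟨u, hu, rfl⟩⟩ := hne
      exact (norm_nonneg (u j)).trans (le_csSup hb ⟨u, hu, rfl⟩)
    · exact (Real.sSup_of_not_bddAbove hb).symm.le
  · rw [not_nonempty_iff_eq_empty] at hne
    simp [hullRadius, hne]

variable [Fintype J]

/-- Polydiscs are bounded. [cite: DupuyHilado2025, §4.12 p. 16] -/
theorem isBounded_polydisc (r : J → ℝ) : IsBounded (polydisc K r) := by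
  refine (isBounded_iff_forall_norm_le).mpr ⟨∑ i, |r i|, fun x hx => ?_⟩
  rw [pi_norm_le_iff_of_nonneg (Finset.sum_nonneg fun i _ => abs_nonneg (r i))]
  intro j
  calc ‖x j‖ ≤ r j := (mem_polydisc K).mp hx j
    _ ≤ |r j| := le_abs_self _
    _ ≤ ∑ i, |r i| := Finset.single_le_sum (fun i _ => abs_nonneg (r i)) (Finset.mem_univ j)

/-- `c·O_L` is bounded (by `‖c‖`). [cite: Mochizuki2012, IUTchIII Rmk. 3.9.5 (i) p. 127] -/
theorem isBounded_hullSet (c : Π j, K j) : IsBounded (hullSet K c) := by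
  refine (isBounded_iff_forall_norm_le).mpr ⟨‖c‖, fun x hx => ?_⟩
  rw [pi_norm_le_iff_of_nonneg (norm_nonneg c)]
  exact fun j => ((mem_polydisc K).mp hx j).trans (norm_le_pi_norm c j)

/-- A hull set is bounded. [cite: Mochizuki2012, IUTchIII Rmk. 3.9.5 (i) p. 127] -/
theorem IsHullSet.isBounded {H : Set (Π j, K j)} (h : IsHullSet K H) : IsBounded H := by
  obtain ⟨c, -, rfl⟩ := h
  exact isBounded_hullSet K c

/-- For bounded `U` the `j`-th norms are bounded above. [cite: DupuyHilado2025, §4.12 p. 16] -/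
theorem bddAbove_norm_image {U : Set (Π j, K j)} (hU : IsBounded U) (j : J) :
    BddAbove ((fun u : Π j, K j => ‖u j‖) '' U) := by
  obtain ⟨R, hR⟩ := isBounded_iff_forall_norm_le.mp hU
  exact ⟨R, by rintro _ ⟨u, hu, rfl⟩; exact (norm_le_pi_norm u j).trans (hR u hu)⟩

/-- `‖u_j‖ ≤ hullRadius U j` for `u ∈ U` bounded. [cite: DupuyHilado2025, §4.12 p. 16] -/
theorem norm_apply_le_hullRadius {U : Set (Π j, K j)} (hU : IsBounded U) {u : Π j, K j} (hu : u ∈ U)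
    (j : J) : ‖u j‖ ≤ hullRadius K U j :=
  le_csSup (bddAbove_norm_image K hU j) ⟨u, hu, rfl⟩

/-- Radii are monotone in `U` (bounded). [cite: Mochizuki2012, IUTchIII Rmk. 3.9.5 (ii) (P3) p. 127] -/
theorem hullRadius_mono {U U' : Set (Π j, K j)} (hU' : IsBounded U') (h : U ⊆ U') (j : J) :
    hullRadius K U j ≤ hullRadius K U' j := by
  by_cases hne : U.Nonempty
  · exact csSup_le_csSup (bddAbove_norm_image K hU' j) (hne.image _) (image_mono h)
  · rw [not_nonempty_iff_eq_empty] at hne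
    subst hne
    simp only [hullRadius, image_empty, Real.sSup_empty]
    exact hullRadius_nonneg K U' j

variable [∀ j, IsUltrametricDist (K j)] [∀ j, ProperSpace (K j)]

/-- **The radii of a bounded nondegenerate set are attained**: there is `u ∈ U` with
`‖u_j‖ = hullRadius U j > 0`. (Compactness of the closure gives a maximiser of the continuous `j`-th
norm on `closure U`; an ultrametric norm is locally constant away from `0`, so a nearby element of `U`
has the same norm.) This is the "well-defined [under the conditions stated]" of Rmk. 3.9.5 (i).
[cite: Mochizuki2012, IUTchIII Rmk. 3.9.5 (i) p. 127] -/
theorem exists_norm_apply_eq_hullRadius {U : Set (Π j, K j)} (hU : IsBounded U)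
    (hnd : IsNondegenerate K U) (j : J) :
    ∃ u ∈ U, ‖u j‖ = hullRadius K U j ∧ 0 < ‖u j‖ := by
  obtain ⟨u₀, hu₀, hu₀j⟩ := hnd j
  have hcl : IsCompact (closure U) := hU.isCompact_closure
  have hne : (closure U).Nonempty := ⟨u₀, subset_closure hu₀⟩
  have hcont : ContinuousOn (fun u : Π j, K j => ‖u j‖) (closure U) :=
    ((continuous_apply j).norm).continuousOn
  obtain ⟨c, hc, hcmax⟩ := hcl.exists_isMaxOn hne hcont
  have hcpos : 0 < ‖c j‖ := lt_of_lt_of_le (norm_pos_iff.mpr hu₀j) (hcmax (subset_closure hu₀))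
  -- an element of `U` close to `c`
  obtain ⟨t, ht, hdist⟩ := Metric.mem_closure_iff.mp hc ‖c j‖ hcpos
  have htj : ‖t j - c j‖ < ‖c j‖ := by
    calc ‖t j - c j‖ = ‖(t - c) j‖ := by simp
      _ ≤ ‖t - c‖ := norm_le_pi_norm _ j
      _ = dist t c := (dist_eq_norm t c).symm
      _ < ‖c j‖ := by rw [dist_comm]; exact hdist
  have hteq : ‖t j‖ = ‖c j‖ := by
    have hne' : ‖t j - c j‖ ≠ ‖c j‖ := htj.ne
    have := IsUltrametricDist.norm_add_eq_max_of_norm_ne_norm hne'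
    rw [sub_add_cancel] at this
    rw [this, max_eq_right htj.le]
  refine ⟨t, ht, le_antisymm (norm_apply_le_hullRadius K hU ht j) ?_, hteq ▸ hcpos⟩
  refine hullRadius_le K ⟨t, ht⟩ fun u hu => ?_
  rw [hteq]
  exact hcmax (subset_closure hu)

/-! ### The holomorphic hull -/

omit [Fintype J] [∀ j, IsUltrametricDist (K j)] [∀ j, ProperSpace (K j)] in
open Classical in
/-- **The holomorphic hull** of `U ⊆ ⊕_j K_j`: the polydisc of radii `(sup_{u∈U} ‖u_j‖)_j` if `U` is
bounded [= relatively compact], and all of `⊕_j K_j` otherwise ("If `U` is not relatively compact, then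
we define the holomorphic hull of `U` to be `I^ℚ(−)`"). For bounded nondegenerate `U` this is the smallest
hull set `λ·O_L` containing `U` (`isHullSet_holomorphicHull`, `holomorphicHull_subset_of_isHullSet`);
for degenerate bounded `U` (some coordinate identically `0` on `U`, a case the source excludes) the
corresponding factor is `{0}`. [cite: Mochizuki2012, IUTchIII Rmk. 3.9.5 (i) p. 127] -/
def holomorphicHull (U : Set (Π j, K j)) : Set (Π j, K j) :=
  if IsBounded U then polydisc K (hullRadius K U) else univ

omit [Fintype J] [∀ j, IsUltrametricDist (K j)] [∀ j, ProperSpace (K j)] in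
/-- The hull of a bounded set is the polydisc of its radii. [cite: Mochizuki2012, IUTchIII Rmk. 3.9.5 (i) p. 127] -/
theorem holomorphicHull_of_isBounded {U : Set (Π j, K j)} (hU : IsBounded U) :
    holomorphicHull K U = polydisc K (hullRadius K U) := by
  simp [holomorphicHull, hU]

omit [Fintype J] [∀ j, IsUltrametricDist (K j)] [∀ j, ProperSpace (K j)] in
/-- The hull of an unbounded set is everything. [cite: Mochizuki2012, IUTchIII Rmk. 3.9.5 (i) p. 127] -/
theorem holomorphicHull_of_not_isBounded {U : Set (Π j, K j)} (hU : ¬ IsBounded U) :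
    holomorphicHull K U = univ := by
  simp [holomorphicHull, hU]

omit [∀ j, IsUltrametricDist (K j)] in
/-- "relatively compact" = bounded in the proper space `⊕_j K_j`.
[cite: Mochizuki2012, IUTchIII Rmk. 3.9.5 (i) p. 127] -/
theorem isBounded_iff_isCompact_closure (U : Set (Π j, K j)) :
    IsBounded U ↔ IsCompact (closure U) :=
  ⟨fun h => h.isCompact_closure, fun h => h.isBounded.subset subset_closure⟩

omit [∀ j, IsUltrametricDist (K j)] [∀ j, ProperSpace (K j)] in
/-- **(P2)** `U ⊆ hull(U)`. [cite: Mochizuki2012, IUTchIII Rmk. 3.9.5 (ii) (P2) p. 127] -/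
theorem subset_holomorphicHull (U : Set (Π j, K j)) : U ⊆ holomorphicHull K U := by
  by_cases hU : IsBounded U
  · rw [holomorphicHull_of_isBounded K hU]
    exact fun u hu => (mem_polydisc K).mpr fun j => norm_apply_le_hullRadius K hU hu j
  · rw [holomorphicHull_of_not_isBounded K hU]
    exact subset_univ U

omit [∀ j, IsUltrametricDist (K j)] [∀ j, ProperSpace (K j)] in
/-- **(P3)** monotonicity: `U ⊆ U'` ⟹ `hull(U) ⊆ hull(U')`.
[cite: Mochizuki2012, IUTchIII Rmk. 3.9.5 (ii) (P3) p. 127] -/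
theorem holomorphicHull_mono {U U' : Set (Π j, K j)} (h : U ⊆ U') :
    holomorphicHull K U ⊆ holomorphicHull K U' := by
  by_cases hU' : IsBounded U'
  · rw [holomorphicHull_of_isBounded K hU', holomorphicHull_of_isBounded K (hU'.subset h)]
    exact polydisc_mono K (hullRadius_mono K hU' h)
  · rw [holomorphicHull_of_not_isBounded K hU']
    exact subset_univ _

omit [∀ j, IsUltrametricDist (K j)] [∀ j, ProperSpace (K j)] in
/-- The radii of a hull set `c·O_L` are `‖c_j‖`. [cite: Mochizuki2012, IUTchIII Rmk. 3.9.5 (i) p. 127] -/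
theorem hullRadius_hullSet (c : Π j, K j) (j : J) : hullRadius K (hullSet K c) j = ‖c j‖ := by
  have hc : c ∈ hullSet K c := (mem_polydisc K).mpr fun i => le_rfl
  exact le_antisymm (hullRadius_le K ⟨c, hc⟩ fun u hu => (mem_polydisc K).mp hu j)
    (norm_apply_le_hullRadius K (isBounded_hullSet K c) hc j)

omit [∀ j, IsUltrametricDist (K j)] [∀ j, ProperSpace (K j)] in
/-- **(P1)** hull sets are their own hulls: `hull(λ·O_L) = λ·O_L`.
[cite: Mochizuki2012, IUTchIII Rmk. 3.9.5 (ii) (P1) p. 127] -/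
theorem holomorphicHull_hullSet (c : Π j, K j) : holomorphicHull K (hullSet K c) = hullSet K c := by
  rw [holomorphicHull_of_isBounded K (isBounded_hullSet K c)]
  unfold hullSet
  congr 1
  funext j
  exact hullRadius_hullSet K c j

omit [∀ j, IsUltrametricDist (K j)] [∀ j, ProperSpace (K j)] in
/-- (P1) for abstract hull sets. [cite: Mochizuki2012, IUTchIII Rmk. 3.9.5 (ii) (P1) p. 127] -/
theorem IsHullSet.holomorphicHull_eq {H : Set (Π j, K j)} (h : IsHullSet K H) :
    holomorphicHull K H = H := by
  obtain ⟨c, -, rfl⟩ := h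
  exact holomorphicHull_hullSet K c

omit [Fintype J] [∀ j, IsUltrametricDist (K j)] [∀ j, ProperSpace (K j)] in
/-- The radii of a subset of a polydisc with nonnegative radii are at most those radii.
[cite: Mochizuki2012, IUTchIII Rmk. 3.9.5 (ii) (P3) p. 127] -/
theorem hullRadius_le_of_subset_polydisc {U : Set (Π j, K j)} {r : J → ℝ} (hr : ∀ j, 0 ≤ r j)
    (h : U ⊆ polydisc K r) (j : J) : hullRadius K U j ≤ r j :=
  hullRadius_le_of_nonneg K (hr j) fun _ hu => (mem_polydisc K).mp (h hu) j

omit [∀ j, IsUltrametricDist (K j)] [∀ j, ProperSpace (K j)] in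
/-- **Minimality**: a hull set containing `U` contains `hull(U)`.
[cite: Mochizuki2012, IUTchIII Rmk. 3.9.5 (i) p. 127] -/
theorem holomorphicHull_subset_of_isHullSet {U H : Set (Π j, K j)} (hH : IsHullSet K H)
    (hUH : U ⊆ H) : holomorphicHull K U ⊆ H := by
  obtain ⟨c, -, rfl⟩ := hH
  rw [holomorphicHull_of_isBounded K ((isBounded_hullSet K c).subset hUH)]
  exact polydisc_mono K (hullRadius_le_of_subset_polydisc K (fun j => norm_nonneg (c j)) hUH)

/-- **Existence** ("well-defined [under the conditions stated]"): the hull of a bounded nondegenerate set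
IS a hull set `λ·O_L` — take `λ_j ∈ pr_j(U)` of maximal norm.
[cite: Mochizuki2012, IUTchIII Rmk. 3.9.5 (i) p. 127] -/
theorem isHullSet_holomorphicHull {U : Set (Π j, K j)} (hU : IsBounded U) (hnd : IsNondegenerate K U) :
    IsHullSet K (holomorphicHull K U) := by
  choose u hu hnorm hpos using fun j => exists_norm_apply_eq_hullRadius K hU hnd j
  refine ⟨fun j => u j j, fun j => norm_pos_iff.mp (hpos j), ?_⟩
  rw [holomorphicHull_of_isBounded K hU]
  unfold hullSet
  congr 1
  funext j
  exact (hnorm j).symm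

/-- **The hull is the smallest hull set containing `U`** (bounded nondegenerate `U`): it is a hull set,
contains `U`, and lies in every hull set containing `U`. [cite: Mochizuki2012, IUTchIII Rmk. 3.9.5 (i) p. 127] -/
theorem isLeast_holomorphicHull {U : Set (Π j, K j)} (hU : IsBounded U) (hnd : IsNondegenerate K U) :
    IsLeast {H : Set (Π j, K j) | IsHullSet K H ∧ U ⊆ H} (holomorphicHull K U) :=
  ⟨⟨isHullSet_holomorphicHull K hU hnd, subset_holomorphicHull K U⟩,
    fun _ hH => holomorphicHull_subset_of_isHullSet K hH.1 hH.2⟩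

/-- **"`φ(P) = ⋂_{H ∋ H ⊇ P} H`"**: the hull of a bounded nondegenerate set is the intersection of all hull
sets containing it. [cite: Mochizuki2012, IUTchIII Rmk. 3.9.5 (ii) p. 127] -/
theorem holomorphicHull_eq_sInter {U : Set (Π j, K j)} (hU : IsBounded U) (hnd : IsNondegenerate K U) :
    holomorphicHull K U = ⋂₀ {H : Set (Π j, K j) | IsHullSet K H ∧ U ⊆ H} := by
  refine le_antisymm ?_ ?_
  · exact subset_sInter fun H hH => holomorphicHull_subset_of_isHullSet K hH.1 hH.2
  · exact sInter_subset_of_mem ⟨isHullSet_holomorphicHull K hU hnd, subset_holomorphicHull K U⟩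

omit [∀ j, IsUltrametricDist (K j)] [∀ j, ProperSpace (K j)] in
/-- The adjunction form of (P2)+(P3): `U ⊆ hull(U')` ⟹ `hull(U) ⊆ hull(U')`.
[cite: Mochizuki2012, IUTchIII Rmk. 3.9.5 (ii) p. 127] -/
theorem holomorphicHull_subset_of_subset_holomorphicHull {U U' : Set (Π j, K j)}
    (h : U ⊆ holomorphicHull K U') : holomorphicHull K U ⊆ holomorphicHull K U' := by
  by_cases hU' : IsBounded U'
  · rw [holomorphicHull_of_isBounded K hU'] at h ⊢
    have hU : IsBounded U := (isBounded_polydisc K _).subset h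
    rw [holomorphicHull_of_isBounded K hU]
    exact polydisc_mono K (hullRadius_le_of_subset_polydisc K (hullRadius_nonneg K U') h)
  · rw [holomorphicHull_of_not_isBounded K hU']
    exact subset_univ _

omit [∀ j, IsUltrametricDist (K j)] [∀ j, ProperSpace (K j)] in
/-- **The holomorphic hull as a closure operator** on the regions of `⊕_j K_j` (extensive (P2), monotone
(P3), idempotent (P1)) — the `hull` field of a volume container. [cite: Mochizuki2012, IUTchIII Rmk. 3.9.5 (ii) p. 127] -/
def hullClosureOperator : ClosureOperator (Set (Π j, K j)) :=
  ClosureOperator.mk₂ (holomorphicHull K) (subset_holomorphicHull K)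
    (fun _ _ h => holomorphicHull_subset_of_subset_holomorphicHull K h)

omit [∀ j, IsUltrametricDist (K j)] [∀ j, ProperSpace (K j)] in
/-- Idempotence: `hull(hull(U)) = hull(U)`. [cite: Mochizuki2012, IUTchIII Rmk. 3.9.5 (ii) (P1) p. 127] -/
theorem holomorphicHull_holomorphicHull (U : Set (Π j, K j)) :
    holomorphicHull K (holomorphicHull K U) = holomorphicHull K U :=
  (hullClosureOperator K).idempotent U

end Literature.IUT.LogVolume
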